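import Mathlib
import HarnessLib
import HarnessLib.Audit
import Summits.Parity.Statement
import Literature.NumberTheory.Sieve.SingularSeries

/-!
Route: HullDial

DORMANT since 2026-09-04T02:20:34Z (reconciler: no traction for 5 d (last activity statement-attached at 2026-08-30T01:27:31Z); parked, not closed — `ledger route dormant route-Parity-HullDial --off` to reactivate) — unstaffed, not closed; items shared with open routes are served there. `ledger route dormant <id> --off` reactivates.

# Route HullDial — Hardy–Littlewood pairs from level ½+δ and HL-mass for pairs of power-residue hull
numbers, by dimension→0 sieves and class averaging

It suffices to show X = HullPairsLevel ∧ HullPairsMass ∧ DialSieveWeights, plus the declared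
GHL-hard residual PairsToGHL (shared
stmt-Parity-9389). Setting (card quartic-hull-descent, with the refuter's tilt repair, gen-1's a/d
law, and the card's DEGREE DIAL made
precise): for a prime ℓ and k ∣ ℓ−1 let H ≤ (ℤ/ℓ)ˣ be the k-th powers (index k; its primes split
completely in the degree-k subfield of
ℚ(ζ_ℓ), density 1/k) and N = N_(ℓ,k) the HULL of integers all of whose prime factors lie in H (#N(x)
≍ x(log x)^(1/k−1)). Prime pairs
(p, p+h) with p, p+h ∈ H are exactly the survivors of sifting hull pairs (n, n+h) by the split
primes < √x — a sieve of tilted local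
dimension ≤ 4·2^(1−1/k)/k → 0. HullPairsLevel (L): one θ > 1/2 such that for all k ≥ 8, even h, the
pair congruence counts A_d have level
x^θ against the tilted two-colour model G, precision X(log x)^(−2/k−δ), uniformly in ℓ ≤ (log x)^8.
HullPairsMass (M): X = #{n ≤ x : n,
n+h ∈ N} ~ 𝔖^N(h)·#N(x)²/x (Hardy–Littlewood for hulls; singular series over the non-split primes
and ℓ only, Freiberg–Kurlberg–Rosenzweig
shape). DialSieveWeights (W): for k ≥ k₀(ε, θ) there are sieve weights of level x^θ whose main terms
against G lie within 1 ± ε of V* =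
(π_H/#N)²·Π_(split p<√x) HL_h(p) (dimension → 0 sieves are exact). Then S_ℓ = #{p ≤ x : p, p+h
prime, p, p+h ∈ H} =
ρ_ℓ(h)·𝔖(h)·x/log²x·(1 ± O(ε)) uniformly in ℓ (DialAssembly, bookkeeping checked by hand), and CLASS
AVERAGING over the primes ℓ ∈
((log x)^8/2, (log x)^8] (ClassAveraging, provable: Jacobi sums + Cauchy–Schwarz) removes the class
condition: π₂,h(x) ~ 𝔖(h)x/log²x for
every even h, i.e. PairsHL (shared stmt-Parity-9387); PairsToGHL carries fixed-shift pairs to the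
sub-problem Statement.
Lean: `HullPairsLevel ∧ HullPairsMass ∧ DialSieveWeights ∧ PairsToGHL`

## Assembly
The deciding theorem is pure logic (glue.lean, lean check rc 0, axioms
propext/Classical.choice/Quot.sound): `closes : HullPairsLevel →
HullPairsMass → DialSieveWeights → ClassAveraging → DialAssembly → PairsToGHL →
GeneralizedHardyLittlewood := fun hL hM hW hC hD hG =>
hG (hD hL hM hW hC)`. All mathematics sits in the items: DialAssembly (bookkeeping, provable) takes
the three cruxes and the provable
ClassAveraging to PairsHL; PairsToGHL is the declared GHL-hard residual shared with
RoughSemiprimeRigidity. DegreeEightPositivity and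
PairsHL are carried as items but are not hypotheses of `closes`.

Rationale: WHY THIS LINE. Mechanism (card quartic-hull-descent): a Chebotarev hull is a SIEVE ENVELOPE of the
primes that has pre-paid the (1 − 1/k) inert part
of the sieve, so that primes — and prime PAIRS in H-classes — are what a residual sieve of dimension
≍ 4/k leaves of hull pairs; the
Rosser–Iwaniec theory (IwaniecActaArith1980; Greaves2001 §4; tree: BetaSieve.*,
half_dimensional_sieve_lower_holds) has sifting limit
1 at dimension ≤ 1/2 and becomes EXACT as the dimension → 0 (fundamental lemma,
HalberstamRichert1974 Thm 2.5, FriedlanderIwaniecOpera2010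
§6), so a level-of-distribution statement θ > 1/2 about a multiplicative pair-set in which no prime
and no Liouville function occurs
yields prime pairs (degree 8: lower bounds, gen-1) and, dialling k → ∞ with an auxiliary average
over ℓ, the Hardy–Littlewood
ASYMPTOTIC for pairs. What is new relative to the retired gen-1 route (route-Parity-HullDescent,
not-a-thesis: it stopped at Polignac in
the class 1 mod 16): (i) power-residue hulls H ≤ (ℤ/ℓ)ˣ instead of H = {1}, so every even shift h is
reachable; (ii) the dial is run in
the auxiliary prime ℓ ≤ (log x)^8 and the class condition is removed by a PROVABLE
large-sieve/Jacobi-sum averaging (ClassAveraging),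
so the route's own content reaches the genuine GHL slice PairsHL; (iii) the hull-pair mass enters as
an explicit Hardy–Littlewood
conjecture for hulls in the ratio form of Freiberg–Kurlberg–Rosenzweig (arXiv:1701.01157, Conj. 1.1
for sums of two squares: 𝔖 = Π over
non-split p of δ_h(p)/δ_0(p)^k), and the singular-series bookkeeping closes exactly: 𝔖^N·Π_split HL
= ρ_ℓ𝔖(h)·(class factor), checked
by hand in NOTES. Imported areas: low-dimensional sieve theory (Rosser–Iwaniec),
multiplicative/frobenian densities (Wirsing,
Landau–Selberg–Delange, Tenenbaum2015 II.5; Loughran–Matthiesen arXiv:1904.12845 for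
finite-complexity correlations of frobenian
functions), character sums (Jacobi sums, IwaniecKowalski2004 Ch. 3, large sieve Ch. 7). Versus prior
routes: MobiusShiftedPrimes /
RoughSemiprimeRigidity / PrimeDeterminantCells pay the parity bit with EH/GEH for PRIMES plus a
prime-side parity atom; here every
hypothesis is about hull numbers (level 1/2+δ, not 1), Bombieri's theorem (EH for primes gives no
pairs) is contrasted with "level 1/2+δ
+ HL-mass for hull pairs gives PairsHL", and the Selberg ghost b(1−λ(n)λ(n+h)) is excluded exactly
by the (log x)^(−δ) margin of L
(λ has relative bias ≍ (log x)^(−2/k) = V on N). Negatives index (2 entries, convolution-moment and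
rectangle-Chowla statements) is not
touched: no full-window Λ⋆Λ convolution and no Chowla input is used.

RANKED CRUXES. #2 HullPairsLevel (crux) — (card C2, repaired and dialled) LEVEL θ > 1/2 FOR HULL
PAIRS, TILTED TWO-COLOUR MODEL, ONE θ FOR ALL DEGREES: there is θ ∈ (1/2, 1) such that for every k ≥
8 and every even h ≥ 2 there is δ > 0 with, for all large x and every prime ℓ ≤ (log x)^8 with k ∣
ℓ−1, ℓ > h: Σ_(d ∣ P(√x), d ≤ x^θ) |A_d(x) − G_x(d)·X(x)| ≤ X(x)·(log x)^(−2/k−δ), where N = {n : p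
∣ n ⇒ p is a non-zero k-th power mod ℓ}, A_d(x) = #{n ≤ x : d ∣ n(n+h), n, n+h ∈ N}, X = A_1, and
for squarefree split-composed d with d₁ = (d, h), d₂ = d/d₁: G_x(d) = (1/d)·Σ_(e f = d₂)
T_x(d₁e)T_x(d₁f), T_x(e) = (1 − log e/log x)^(−(1−1/k)) (e ↔ the part of d dividing n, f ↔ the part
dividing n+h; a split prime dividing h divides both), G_x = 0 otherwise. V(√x) ≍ (log x)^(−2/k), so
this is R(𝒜, x^θ) ≤ XV(log x)^(−δ) with the x-dependent main terms forced by the tilt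
(refuter-triage-10 numerics: p·A_p/#N = 1.12…1.67 vs (1−u)^(−3/4) = 1.12…1.64 at k = 4, x = 3·10⁷);
model defects are O(1/log x) ≪ (log x)^(−2/k−δ). [difficulty: open-problem] (why it might fail:
Absolute level > 1/2 for a binary (hull-pair) indicator is Elliott–Halberstam-type
(LargeSieveLevelHalf); even d ≤ (log x)^A needs hull pairs equidistributed to (log x)^(−2/k−δ); a
secondary term of relative size ≥ (log x)^(−2/k) in A_d/X, or ℓ-non-uniformity below (log x)^8,
falsifies G as typed.) [BombieriFriedlanderIwaniecActa1986, ZhangAnnals2014, Polymath8a2014,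
Maynard2020LargeModuliII, IwaniecActaArith1980, arXiv:1904.12845,
Literature.Barriers.Parity.LargeSieveLevelHalf]
#3 DialSieveWeights (crux) — DIMENSION → 0 SIEVES ARE EXACT FOR THE TILTED MODEL: for every ε > 0
and θ ∈ (1/2, 1) there is k₀ such that for all k ≥ k₀, even h, all large x and every prime ℓ ≤ (log
x)^8 with k ∣ ℓ−1, ℓ > h, there exist weights λ± : ℕ → [−1, 1] supported on {d ∣ P(√x), d ≤ x^θ}
with the sieve inequalities Σ_(d∣m) λ⁻(d) ≤ 1[(m, P(√x)) = 1] ≤ Σ_(d∣m) λ⁺(d) for all m ≥ 1, and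
(1−ε)V* ≤ Σ_d λ⁻(d)G_x(d), Σ_d λ⁺(d)G_x(d) ≤ (1+ε)V*, where V*(x) = (π_H(x)/#N(x))²·Π_(p<√x, p
split, p∤h)(1 − 2/p)(1−1/p)^(−2)·Π_(p<√x, p split, p∣h)(1−1/p)^(−1) (π_H = primes ≤ x in H, #N =
hull numbers ≤ x). Expected proof: Rosser's β = 1 truncations (tree BetaSieve.pred/ind,
lower_sieve/upper_sieve) lose O(κ²) resp. O(κ log(2/s)) of the main term at s = 2θ > 1 when the
local dimension κ ≤ 4·2^(1−1/k)/k → 0 (two-colour tilted Buchstab iteration, IwaniecActaArith1980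
§§4–9 redone state by state as in gen-1's TiltedSieveMainTerm); the single-colour functional is
identified with π_H/#N by the Legendre identity for the hull plus Landau–Selberg–Delange for
#N(x/e)/#N(x) = T_x(e)/e·(1 + O(1/log x)) uniformly in ℓ ≤ (log x)^8 (Siegel–Walfisz range; tree
siegel_walfisz_holds), and the pair functional factors as (single)² × split HL-factors up to 1 +
o(1) (coprimality of the two colours off h; T ↦ 1 costs Σ_p u_p/p² → 0). [difficulty: L] (why it
might fail: G_x is x-dependent and non-multiplicative (T(d₁e)T(d₁f) couples colours via the tilt and
the primes of h); if the two-colour Buchstab recursion keeps a boundary loss bounded below at s = 2θ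
≤ 2 as κ → 0, or LSD uniformity in ℓ ≤ (log x)^8 fails (real character mod ℓ, even k), no k₀
exists.) [IwaniecActaArith1980, doi:10.4064/aa-29-1-69-95, HalberstamRichert1974,
FriedlanderIwaniecOpera2010, Greaves2001, Tenenbaum2015,
Literature.NumberTheory.Sieve.SieveSequence.half_dimensional_sieve_lower_holds]
#4 HullPairsMass (crux) — (card C1, made explicit) HARDY–LITTLEWOOD FOR HULL PAIRS, ratio form with
finite products only: for every k ≥ 8, even h ≥ 2 and ε > 0, for all large x and every prime ℓ ≤
(log x)^8 with k ∣ ℓ−1, ℓ > h: |x·X(x) − 𝔖^N_x(h)·#N(x)²| ≤ ε·#N(x)², where 𝔖^N_x(h) = [#{u mod ℓ :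
u, u+h ∈ H}·ℓ/|H|²]·Π_(p<√x, p≠ℓ, p non-split) (1 − ν_h(p)/p)(1 − 1/p)^(−2), |H| = (ℓ−1)/k, ν_h(p) =
1 if p ∣ h else 2 (split primes impose no local condition on hull membership and contribute no
factor; the factor at ℓ is the compatibility of the two H-classes). This is the k = 2-pair case of
the Freiberg–Kurlberg–Rosenzweig-type k-tuple conjecture for the frobenian set N (their Conj. 1.1 is
the sums-of-two-squares analogue, 𝔖 = Π_(p non-split) δ_h(p)/δ_0(p)^k); finite-complexity
correlations of frobenian functions are theorems (Loughran–Matthiesen), the pair (n, n+h) is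
infinite complexity. [difficulty: open-problem] (why it might fail: Open binary problem of B-twin
type (Indlekofer 1974: only the order, for sums of two squares, via r(n)); the local-density
heuristic for a density-zero multiplicative set may miss a global factor (Mertens-type paradox) or
fail uniformly in ℓ ≤ (log x)^8; k = 8, x ≤ 10⁹ numerics decide.) [arXiv:1701.01157,
doi:10.4064/aa-26-2-207-212, arXiv:1904.12845, arXiv:1106.4690, Tenenbaum2015, HardyLittlewood1923]
#9 ClassAveraging (support) — PROVABLE NOW (L in Lean): for every k ≥ 1 and h ≥ 1, π₂,h(x) −
(1/|L_x|)·Σ_(ℓ ∈ L_x) S_ℓ(x)/ρ_ℓ = o(x/log²x), where L_x = {primes ℓ ∈ ((log x)^8/2, (log x)^8] : k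
∣ ℓ−1, ℓ > h}, S_ℓ(x) = #{p ≤ x : p, p+h prime, p and p+h non-zero k-th powers mod ℓ}, ρ_ℓ = #{u mod
ℓ : u, u+h ∈ H}/#{u mod ℓ : u ≢ 0, −h}, π₂,h(x) = #{p ≤ x : p, p+h prime}. Proof: 1_H =
(1/k)Σ_(χ^k=1) χ; the trivial pair gives π₂,h(x)/k² + O((log x)^8); ρ_ℓ = k^(−2)(1 + O(k²ℓ^(−1/2)))
by Jacobi sums; the non-trivial character pairs are bounded by Cauchy–Schwarz over p ≤ x (weights
a_p ∈ [0,1], Σa_p ≤ π(x), Chebyshev) against Σ_(n≤x)|Σ_ℓ c_ℓ Σ' χ₁(n)χ₂(n+h)|², whose off-diagonal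
complete sums mod ℓℓ' factor into Jacobi-type sums of modulus √(ℓℓ') (plus O(ℓℓ') ≤ (log x)^16
boundary), giving ≪ k⁴|L_x|x; hence error/main ≍ k²φ(k)^(1/2)(log x)^(3/2)|L_x|^(−1/2) ≍ (log
x)^(−5/2+o(1)) → 0 since |L_x| ≍ (log x)^8/(8φ(k) log log x) (PNT in APs mod k, fixed modulus).
[difficulty: provable-now] [IwaniecKowalski2004, MontgomeryVaughan2007,
Literature.Barriers.Parity.LargeSieveLevelHalf]
#9 DialAssembly (support) — PROVABLE BOOKKEEPING (M/L): HullPairsLevel → HullPairsMass →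
DialSieveWeights → ClassAveraging → PairsHL (PairsHL spelled out verbatim so the decl does not
depend on rendering order). Fix h; odd h: 𝔖({0,h}) = 0 (tree singularSeriesFactor_eq_zero at p = 2)
and Σ_(n≤N)Λ(n)Λ(n+h) ≪ log³N (one of n, n+h is a power of 2). Even h, ε > 0: take θ from L, k ≥
max(8, k₀(ε, θ)) from W; for large x and each ℓ ∈ L_x the weights give X[(1−ε)V* − (log x)^(−2/k−δ)]
≤ S ≤ X[(1+ε)V* + (log x)^(−2/k−δ)] for the survivors S = #{n ≤ x : n, n+h ∈ N, (n(n+h), P(√x)) = 1}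
= S_ℓ(x) + O(√x) (a hull number ≤ x+h free of primes < √x is 1, a prime in H, or q² with q ≥ √x),
and (log x)^(−2/k−δ) = o(V*) uniformly in ℓ ≤ (log x)^8 (V* ≍ (log x)^(−2/k)·(log ℓ)^(O(1/k))/k²).
With M: S_ℓ = 𝔖^N_x·Π_(split p<√x)HL_h(p)·π_H(x)²/x·(1 ± 3ε) = [#{u,u+h∈H}ℓ/|H|²]·[Π_(p<√x,
p≠ℓ)HL_h(p)]·[|H|/(ℓ−1)·x/log x]²/x·(1 ± 4ε) (Siegel–Walfisz for π_H, tree siegel_walfisz_holds;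
singularSeriesPartial → 𝔖(h), tree tendsto_singularSeriesPartial_holds) =
#{u,u+h∈H}·ℓ/((ℓ−1)²−1)·𝔖(h)x/log²x(1 ± 5ε) = ρ_ℓ·𝔖(h)·x/log²x·(1 ± 5ε) since (ℓ−1)²−1 = ℓ(ℓ−2) and
#{u : u ≢ 0,−h} = ℓ−2. ClassAveraging then gives π₂,h(x) = 𝔖(h)x/log²x(1 ± 6ε) for all large x,
every ε, hence π₂,h ~ 𝔖 x/log²x, and partial summation (prime powers O(√x log²x)) gives
Σ_(n≤N)Λ(n)Λ(n+h) = 𝔖({0,h})N + o(N). [difficulty: M] [IwaniecActaArith1980, HardyLittlewood1923,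
Literature.NumberTheory.Sieve.tendsto_singularSeriesPartial_holds,
Literature.NumberTheory.LFunctions.siegel_walfisz_holds]
#9 PairsHL (support) — Hardy–Littlewood pairs, Λ-form, fixed shift: for every h ≥ 1, Σ_(n≤N)
Λ(n)Λ(n+h) = 𝔖({0,h})·N + o(N). Verbatim the shared item stmt-Parity-9387 (TauberianTwins.PairsHL /
RoughSemiprimeRigidity.PairsHL): the terminal statement of this route's own content (k-tuples,
general slopes and shift-uniform GHL are NOT claimed). [difficulty: open-problem]
[HardyLittlewood1923, GreenTao2010]
#9 PairsToGHL (support) — RESIDUAL — GHL-hard, NOT addressed by this mechanism; filed so that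
`closes` decides the sub-problem (D-0027 §2.1); verbatim the shared item stmt-Parity-9389:
fixed-shift Hardy–Littlewood pairs (PairsHL inlined) → GeneralizedHardyLittlewood. Contains prime
k-tuples for k ≥ 3 (a k-fold hull descent has residual dimension ≍ 2k/degree and needs k-fold hull
correlations), general slopes, shift-uniformity |b_i| ≤ LN (Landau–Siegel-hard,
MatomakiMerikoski2023 Thm 1.3) and the fibration d ≥ 2 ⇐ d = 1 (route DicksonFibration, provable).
True if GHL is. [difficulty: open-problem] [GreenTao2010, MatomakiMerikoski2023,
HardyLittlewood1923]
#9 DegreeEightPositivity (support) — (card headline as repaired by refuter-triage-10 / gen-1; NOT a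
hypothesis of `closes`; first milestone and cheapest kit falsifier) at degree k = 8 the β = 1 ROSSER
LOWER SIEVE HAS A POSITIVE MAIN TERM for the tilted two-colour model: for every θ ∈ (1/2, 3/5] and
even h there is c > 0 with, for all large x and every prime ℓ ≤ (log x)^8, 8 ∣ ℓ−1, ℓ > h:
Σ_(d∣P(√x)) μ(d)χ⁻_(x^θ)(d)G_x(d) ≥ c·V*(x), χ⁻ = Rosser's lower truncation with β = 1 written
non-recursively (for each prime q ∣ d of even rank m from the top, (Π_(p∣d, p≥q) p)·q < x^θ; = tree
BetaSieve.ind 0 1 (x^θ)). By gen-1's a/d law the tilted local dimension over Buchstab states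
reachable with d < x^θ, θ ≤ 0.7, is ≤ 2·(1/8)·2^(7/8) = 0.458 < 1/2, so Iwaniec's one-sided Ω(1/2)
comparison applies state by state and the sum is ≥ (f_(1/2)(2θ) − o(1))·(single functional)²·(split
factors), f_(1/2)(1.1) = 0.447, f_(1/2)(1.2) = 0.596. With HullPairsLevel at k = 8 and any lower
bound X ≫ x(log x)^(−2) this yields infinitely many prime pairs (p, p+h) in H×H (Polignac for every
even h in power-residue classes) via tree lowerSum_le_sifted — the route's lower-bound milestone,
not needed by `closes`. [difficulty: L] [IwaniecActaArith1980, doi:10.4064/aa-29-1-69-95,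
Greaves2001, FriedlanderIwaniecOpera2010,
Literature.NumberTheory.Sieve.SieveSequence.half_dimensional_sieve_lower_holds]

TWO-LAYER PLAN. Foreseen glued splits (filed only after a crux closes or a prover asks).
DialSieveWeights ⇐ SingleColourFunctional (Legendre identity +
LSD: the tilted one-colour Rosser sums equal π_H/#N up to factors 1 ± η_k with η_k → 0, uniformly in
ℓ) →
TwoColourFactorisation (pair functional = single² × split HL-factors × (1+o(1)), boundary losses
O(κ²), O(κ log(2/s))) →
DialSieveWeights. HullPairsLevel ⇐ HullPairsSW (hull pairs in a fixed class to (log x)^(−A), itself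
binary) → HullPairsBV (θ < 1/2 by the
large sieve from SW) → HullPairsBeyondHalf (the increment (1/2, 1/2+δ] for factorable Rosser moduli
by dispersion, BFI/Zhang shape, fed
by hull pairs averaged over dilations as in Matomäki–Radziwiłł–Tao's shift-averaged HL) →
HullPairsLevel. HullPairsMass ⇐ (if attacked)
HullPairsUpperLower (order of magnitude by vector sieve / Indlekofer-type arguments) →
HullPairsConstant. DialAssembly ⇐
SurvivorsArePrimePairs (Rosser/Legendre bookkeeping, tree lowerSum_le_sifted / sifted_le_upperSum) →
SingularSeriesConsistency
(𝔖^N_x·Π_split HL·(|H|/(ℓ−1))²·#{…}ℓ/|H|² = ρ_ℓ𝔖(h)(1+o(1))) → DialAssembly. The degree-8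
lower-bound milestone (DegreeEightPositivity +
HullPairsLevel at k = 8 + X ≫ x/log²x ⟹ Polignac in H×H classes) is a support theorem provers may
land at any time with `--supports`.

KILL CRITERIA. HullPairsLevel refuted STRUCTURALLY (an Ω-theorem: hull pairs have absolute level ≤
1/2 for some k, h) ⇒ restate in well-factorable /
smooth-moduli form (Iwaniec's bilinear remainder; Zhang–Polymath shape) with a new decl, once;
refuted again ⇒ `close --reason
refuted:HullPairsLevel`. Refuted AS TYPED by a secondary main term (relative size ≥ (log x)^(−2/k)
in A_d/X) or by the tilt exponent ⇒
misstated: add the repaired model (two-term LSD density / corrected local factors) as a new item and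
re-certify glue. DialSieveWeights
refuted (boundary loss bounded below as κ → 0 at s ≤ 2) ⇒ the dial is dead: the route shrinks to the
degree-8 lower-bound milestone,
which does not decide the Statement ⇒ close `refuted:DialSieveWeights` and re-card the lower bound
under BatemanHorn-type sub-problems
if any. HullPairsMass refuted numerically (constant visibly ≠ 𝔖^N at k = 8, x = 10⁹, beyond
secondary-term drift) ⇒ misstated if a
corrected local factor fits, substantive (close `refuted:HullPairsMass`) if no local-density
constant fits. A bookkeeping proof that
HullPairsLevel ∧ HullPairsMass at one (ℓ, k) already implies HL for (n, n+h) in progressions mod ℓ ⇒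
the route is a reformulation: close
`superseded`. PairsHL proved by another route ⇒ moot (close `superseded --by`). PairsToGHL is the
residual: never a reason to pivot.

NOT DECOMPOSED YET. The explicit k₀(ε, θ) and the continuous two-colour delay system behind
DialSieveWeights; the three natural pieces of HullPairsLevel and
its well-factorable weakening (all the β-sieve needs, IwaniecActaArith1980 bilinear form); the
k-TUPLE dial (t-fold hull products,
residual dimension ≍ 2t·2^(1−1/k)/k, which would reach fixed-shift k-tuples and shrink PairsToGHL to
slopes + uniformity + fibration) —
deliberately not filed: one dial at a time; the choice of the auxiliary window ((log x)^8 is far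
more than ClassAveraging needs,
(log x)^(3+ε) suffices) and of the family of k (all k ≥ 8 vs powers of 2); the degree-8 Polignac
milestone as a formal item chain
(kept as the single support DegreeEightPositivity); general frobenian hulls (any abelian field) and
weighted hulls r_K(n)^α (the a/d
law says only α/k matters: α = 1 gives the GL(k) additive-divisor problem with dimension 2, α → 0
the indicator with dimension → 0 —
the conservation the card is about).

CHEAPEST FALSIFIER. (1) KIT, pure analysis: solve the two-colour tilted Buchstab/Rosser recursion (β
= 1) for local dimension profile
(1/k)[(1−u/(1−U₁))^(−(1−1/k)) + (1−u/(1−U₂))^(−(1−1/k))] on a grid, k ∈ {8, 16, 32, 64}, s ∈ [1.02,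
2]: read off the lower/upper main-term
ratios f̃_k(s), F̃_k(s); DegreeEightPositivity dies if f̃_8 ≤ 0 on (1, 1.2], DialSieveWeights dies
if F̃_k − f̃_k does not → 0. (2)
NUMERICS x ≤ 10⁹, k = 8, ℓ ∈ {17, 41, 73, 89, 97}, h ∈ {2, 6, 30}: (a) x·X/#N² against 𝔖^N_x(h)
(HullPairsMass; expect agreement to
1/log x); (b) p·A_p/X against 2T_x(p) = 2(1 − log p/log x)^(−7/8) for split p ∤ h and T_x(p)² for
split p ∣ h (HullPairsLevel's model; the
refuter's tilt_check.py at k = 4 matched singles to 2 %); (c) S_ℓ(x)/(ρ_ℓ·𝔖(h)·Li₂(x)) ≈ 1 (sanity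
of the bookkeeping, HL-true). (3)
LOOKUP: does a printed 'HL conjecture for frobenian multiplicative sets' with numerics exist beyond
sums of two squares (FKR 2017,
Connors–Keating 1997, Smilansky 2013)? If it prints our 𝔖^N the Mass crux is 'known-conjecture'
(fine) and its numerics transfer. Not
run here: the hub is compute-free and this seat is one-shot; (1) is decisive for the engine, (2a)
for the mass constant.

NUMBERS. Split density 1/k; #N_(ℓ,k)(x) ~ c_(ℓ,k)·x(log x)^(1/k−1) (Wirsing/LSD, Tenenbaum2015
II.5); hull-pair mass ≍ x(log x)^(2/k−2); V(√x) ≍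
(log x)^(−2/k); tilted local pair dimension 2(1/k)(1−u)^(−(1−1/k)), sup over u ≤ 1/2 =
(2/k)·2^(1−1/k) = 0.458 (k=8), 0.229 (16), 0.115
(32), 0.057 (64) → 0; over Buchstab states reachable with d < x^θ the sup stays at these values for
θ ≤ 0.7 (gen-1). β_(1/2) = 1 (tree
iwaniecSiftingLimit_half); s^(1/2)f_(1/2)(s) = (e^γ/π)^(1/2)·2log(√s+√(s−1)): f_(1/2)(1.1) = 0.447,
f(1.2) = 0.596, f(2) = 0.939, F_(1/2)(2)
= 1.065; fundamental-lemma loss at fixed s as κ → 0: ≤ exp(−s(log s − loglog 3s − log κ − 2))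
(HalberstamRichert1974 Thm 2.5). Refuter
numerics (k = 4, x = 3·10⁷, #N₅ = 703560): p·A_p/#N = 1.12, 1.27, 1.39, 1.56, 1.67 at u = 0.14…0.48
vs (1−u)^(−3/4) = 1.12…1.64.
ClassAveraging budget: |L_x| ≍ (log x)^8/(8φ(k)loglog x), character-sum error/main ≍
k²φ(k)^(1/2)(log x)^(−5/2)(loglog x)^(1/2); ρ_ℓ =
k^(−2)(1 + O(k²ℓ^(−1/2))). Known levels for PRIMES: 1/2 (BV, tree
BombieriVinogradovStatement_holds), 1/2 + 7/300 smooth moduli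
(Polymath8a2014), 4/7 and 3/5 well-factorable (BombieriFriedlanderIwaniecActa1986,
Maynard2020LargeModuliII). Items at open: 9 (3 cruxes,
5 support incl. the shared PairsHL / PairsToGHL, 1 assembly) + the proved `closes`; imports:
Literature.NumberTheory.Sieve.SingularSeries only.

DEFINITION REQUESTS. None needed to open: res/hull/A/T/G/V*/𝔖^N/χ⁻ are inlined by `let` over Mathlib
(ZMod, primorial, Nat.primeFactors) so that the route
imports nothing carrying an unproved named fact. If the route gains traction: `--kind definition
--notion PowerResidueHull --topic
Literature/NumberTheory/Sieve` (N_(ℓ,k) with its Wirsing/LSD asymptotic as a cite fact,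
Tenenbaum2015 II.5 Thm 5.2), `--notion
TiltedPairDensity` (G_x) and `--notion RosserTruncation` re-exported from
SieveFrameworkFundamentalLemma without the LevelOfDistribution
import (operator: SieveFramework imports LevelOfDistribution only for unrelated decls); cite facts
wanted: Freiberg–Kurlberg–Rosenzweig
Conj. 1.1 (arXiv:1701.01157) as the named k-tuple conjecture for sums of two squares (comparator),
Indlekofer 1974 B-twins
(doi:10.4064/aa-26-2-207-212).

Novelty: Searches (2026-08-15, this seat; local searchd/graph daemon DOWN (rc 75, connection reset), OpenAlex
budget exhausted, zbMATH/arXiv API 0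
rows — recorded as not consulted; Semantic Scholar worked): `lit search --source s2 "Poisson
distribution for gaps between sums of two
squares"` (4 rows → Freiberg–Kurlberg–Rosenzweig 2017, doi:10.4310/cntp.2017.v11.n4.a3 =
arXiv:1701.01157, READ pp. 2–7: Conj. 1.1,
𝔖_h = Π_(p≢1(4)) δ_h(p)/δ_0(p)^k, consistency/averages §2); `ledger negatives --problem Parity` (2,
unrelated); tree search (lean search)
for BetaSieve.pred/ind, primesProdBelow, singularSeries, siegel_walfisz_holds,
BombieriVinogradovStatement_holds (all located; the
last two PROVED); inherited from the card and gen-1 (same day): `lit search --hybrid "half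
dimensional sieve prime pairs sifted set
primes congruent 1 mod"` (12 held: Greaves, Hooley, FHIK lectures, Harman — no hull-pair sieve),
`lit vsearch "sieve with density
depending on log d/log x, variable dimension Buchstab"` (Greaves pp. 229–230 vector sieve, read by
gen-1), `lit search --source zbmath
"B-Zwillinge"` (Indlekofer–Schwarz 1972, Indlekofer 1974, Bantle 1985/86), `"correlations of sums of
two squares"` (arXiv:1701.04092,
arXiv:1106.4690, arXiv:1205.4145), `lit galaxy search "all of whose prime factors are congruent to
1" --star all` (1 hit, Buell), `lit
frontier Parity --since 2021`, `lit bridges Parity --cross any` (nothing bearing), Iwaniec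
1972/1976/1980, Loughran–Matthiesen
arXiv:1904.12845, Opera de Cribro  [refs: 10.4310/cntp.2017.v11.n4.a3, 10.4064/aa-29-1-69-95, 1701.01157, 1701.04092, 1106.4690, 1205.4145, 1904.12845, doi:10.4310/cntp.2017.v11.n4.a3, doi:10.4064/aa-29-1-69-95]

Barriers (technique_class: low-dim-sieve level-of-distribution hull class-averaging): - technique_class: low-dim-sieve level-of-distribution hull class-averaging
- Literature.Barriers.Parity.SelbergParityBarrier: evaded at the prime-producing step only — the
residual sieve has local dimension ≤ 0.458 (k = 8) → 0 (dial), sifting limit 1 < 2θ, so Type-I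
indistinguishability of b and b(1 ± λ(n)λ(n+h)) does not bite on the sieve step: the ghost violates
HullPairsLevel by exactly its (log x)^(−δ) margin (λ has relative bias ≍ (log x)^(−2/k) = V on N,
1/Γ(−2/k) ≠ 0); globally the parity content is RELOCATED into HullPairsLevel's precision and
HullPairsMass, not removed, and said so.
- Literature.Barriers.Parity.LargeSieveLevelHalf: it does not evade; HullPairsLevel asks absolute
level θ > 1/2 for a pair sequence. The bet: ANY fixed θ > 1/2 suffices for every k (dimension → 0
makes s = 2θ > 1 enough), Rosser moduli are flexibly factorable, and level beyond 1/2 is known for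
primes in exactly such shapes (Zhang/Polymath8a smooth moduli in absolute value, BFI/Maynard
well-factorable) — dispersion, not the large sieve, is the intended engine for (1/2, 1/2+δ].
ClassAveraging USES the large sieve/duality only in the provable direction (moduli ℓ ≤ (log x)^8 ≪
x^(1/2)).
- Literature.Barriers.Parity.PrimePairParity: consistent — no weight-insertion-invariant deduction
of prime pairs from Type-I/II data of the prime indicator or of {p+h}; the inputs are distribution +
mass statements about a different sequence (hull pairs) whose Möbius shadow is exactly the kind of
input Polym

History (route lifecycle, newest last):
- 2026-08-24T20:39:24Z · DORMANT — reconciler: no traction for 7.1 d (last activity statement-attached at 2026-08-17T18:44:29Z); parked, not closed — `ledger route dormant route-Parity-HullDial - (operator:999:1559456)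
- 2026-08-28T19:19:58Z · REACTIVATED — reconciler: reactivated — activity item-evidence-added at 2026-08-28T17:02:41Z after parking at 2026-08-24T20:39:24Z (operator:999:2212769)
- 2026-09-04T02:20:34Z · DORMANT — reconciler: no traction for 5 d (last activity statement-attached at 2026-08-30T01:27:31Z); parked, not closed — `ledger route dormant route-Parity-HullDial --o (operator:999:2541107)

sub-problem: GeneralizedHardyLittlewood · status: dormant · opened planner-plancard-Parity-GeneralizedHardyLittl-d0f3a14a-g2-0 2026-08-15T19:00:13Z · rev 1 · ledger route-Parity-HullDial
GENERATED by the gate from the ledger (D-0016/17). Provers cite these decls: `theorem foo : Summit.Parity.GeneralizedHardyLittlewood.Theses.HullDial.<Decl> := …` in Summits/Parity/GeneralizedHardyLittlewood/Theorems/<Name>.lean.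
-/

namespace Summit.Parity.GeneralizedHardyLittlewood.Theses.HullDial

open scoped BigOperators Topology Manifold Classical MeasureTheory ProbabilityTheory Matrix InnerProductSpace ComplexConjugate ContinuousMap
open Filter Set Function TopologicalSpace MeasureTheory

attribute [summit_statement] _root_.GeneralizedHardyLittlewood

/-- item stmt-Parity-13090 · crux · rank 2 · open · by planner
why it might fail: Absolute level > 1/2 for a binary (hull-pair) indicator is Elliott–Halberstam-type (LargeSieveLevelHalf); even d ≤ (log x)^A needs hull pairs equidistributed to (log x)^(−2/k−δ); a secondary term of relative size ≥ (log x)^(−2/k) in A_d/X, or ℓ-non-uniformity below (log x)^8, falsifies G as typed.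
sources: BombieriFriedlanderIwaniecActa1986, ZhangAnnals2014, Polymath8a2014, Maynard2020LargeModuliII, IwaniecActaArith1980, arXiv:1904.12845
[crux] (card C2, repaired and dialled) LEVEL θ > 1/2 FOR HULL PAIRS, TILTED TWO-COLOUR MODEL, ONE θ
FOR ALL DEGREES: there is θ ∈ (1/2, 1) such that for every k ≥ 8 and every even h ≥ 2 there is δ > 0
with, for all large x and every prime ℓ ≤ (log x)^8 with k ∣ ℓ−1, ℓ > h: Σ_(d ∣ P(√x), d ≤ x^θ)
|A_d(x) − G_x(d)·X(x)| ≤ X(x)·(log x)^(−2/k−δ), where N = {n : p ∣ n ⇒ p is a non-zero k-th power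
mod ℓ}, A_d(x) = #{n ≤ x : d ∣ n(n+h), n, n+h ∈ N}, X = A_1, and for squarefree split-composed d
with d₁ = (d, h), d₂ = d/d₁: G_x(d) = (1/d)·Σ_(e f = d₂) T_x(d₁e)T_x(d₁f), T_x(e) = (1 − log e/log
x)^(−(1−1/k)) (e ↔ the part of d dividing n, f ↔ the part dividing n+h; a split prime dividing h
divides both), G_x = 0 otherwise. V(√x) ≍ (log x)^(−2/k), so this is R(𝒜, x^θ) ≤ XV(log x)^(−δ) with
the x-dependent main terms forced by the tilt (refuter-triage-10 numerics: p·A_p/#N = 1.12…1.67 vs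
(1−u)^(−3/4) = 1.12…1.64 at k = 4, x = 3·10⁷); model defects are O(1/log x) ≪ (log x)^(−2/k−δ).
[difficulty: open-problem] -/
@[route_item "route-Parity-HullDial"]
def HullPairsLevel : Prop :=
  let res : ℕ → ℕ → ℕ → Prop := fun ℓ k u => ∃ v : ZMod ℓ, v ≠ 0 ∧ v ^ k = (u : ZMod ℓ); let hull : ℕ → ℕ → ℕ → Prop := fun ℓ k n => ∀ p ∈ n.primeFactors, res ℓ k p; let A : ℕ → ℕ → ℕ → ℝ → ℕ → ℝ := fun ℓ k h x d => (((Finset.Icc 1 ⌊x⌋₊).filter (fun n => d ∣ n * (n + h) ∧ hull ℓ k n ∧ hull ℓ k (n + h))).card : ℝ); let T : ℕ → ℝ → ℕ → ℝ := fun k x e => (1 - Real.log (e : ℝ) / Real.log x) ^ (-(1 - 1 / (k : ℝ))); let G : ℕ → ℕ → ℕ → ℝ → ℕ → ℝ := fun ℓ k h x d => if Squarefree d ∧ (∀ p ∈ d.primeFactors, res ℓ k p) then (1 / (d : ℝ)) * ∑ e ∈ (d / Nat.gcd d h).divisors, T k x (Nat.gcd d h * e) * T k x (Nat.gcd d h *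 (d / Nat.gcd d h / e)) else 0; ∃ θ : ℝ, 1 / 2 < θ ∧ θ < 1 ∧ ∀ k : ℕ, 8 ≤ k → ∀ h : ℕ, 1 ≤ h → Even h → ∃ δ : ℝ, 0 < δ ∧ ∀ᶠ x : ℝ in Filter.atTop, ∀ ℓ : ℕ, ℓ.Prime → (ℓ : ℝ) ≤ Real.log x ^ 8 → k ∣ ℓ - 1 → h < ℓ → ∑ d ∈ (primorial (⌈Real.sqrt x⌉₊ - 1)).divisors.filter (fun d : ℕ => (d : ℝ) ≤ x ^ θ), |A ℓ k h x d - G ℓ k h x d * A ℓ k h x 1| ≤ A ℓ k h x 1 * Real.log x ^ (-(2 / (k : ℝ)) - δ)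

/-- item stmt-Parity-13091 · crux · rank 3 · open · by planner
why it might fail: G_x is x-dependent and non-multiplicative (T(d₁e)T(d₁f) couples colours via the tilt and the primes of h); if the two-colour Buchstab recursion keeps a boundary loss bounded below at s = 2θ ≤ 2 as κ → 0, or LSD uniformity in ℓ ≤ (log x)^8 fails (real character mod ℓ, even k), no k₀ exists.
sources: IwaniecActaArith1980, doi:10.4064/aa-29-1-69-95, HalberstamRichert1974, FriedlanderIwaniecOpera2010, Greaves2001, Tenenbaum2015
[crux] DIMENSION → 0 SIEVES ARE EXACT FOR THE TILTED MODEL: for every ε > 0 and θ ∈ (1/2, 1) there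
is k₀ such that for all k ≥ k₀, even h, all large x and every prime ℓ ≤ (log x)^8 with k ∣ ℓ−1, ℓ >
h, there exist weights λ± : ℕ → [−1, 1] supported on {d ∣ P(√x), d ≤ x^θ} with the sieve
inequalities Σ_(d∣m) λ⁻(d) ≤ 1[(m, P(√x)) = 1] ≤ Σ_(d∣m) λ⁺(d) for all m ≥ 1, and (1−ε)V* ≤ Σ_d
λ⁻(d)G_x(d), Σ_d λ⁺(d)G_x(d) ≤ (1+ε)V*, where V*(x) = (π_H(x)/#N(x))²·Π_(p<√x, p split, p∤h)(1 −
2/p)(1−1/p)^(−2)·Π_(p<√x, p split, p∣h)(1−1/p)^(−1) (π_H = primes ≤ x in H, #N = hull numbers ≤ x).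
Expected proof: Rosser's β = 1 truncations (tree BetaSieve.pred/ind, lower_sieve/upper_sieve) lose
O(κ²) resp. O(κ log(2/s)) of the main term at s = 2θ > 1 when the local dimension κ ≤ 4·2^(1−1/k)/k
→ 0 (two-colour tilted Buchstab iteration, IwaniecActaArith1980 §§4–9 redone state by state as in
gen-1's TiltedSieveMainTerm); the single-colour functional is identified with π_H/#N by the Legendre
identity for the hull plus Landau–Selberg–Delange for #N(x/e)/#N(x) = T_x(e)/e·(1 + O(1/log x))
uniformly in ℓ ≤ (log x)^8 (Siegel–Walfisz range; tree siegel_walfisz_holds), and the pair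
functional factors as (single)² × -/
@[route_item "route-Parity-HullDial"]
def DialSieveWeights : Prop :=
  let res : ℕ → ℕ → ℕ → Prop := fun ℓ k u => ∃ v : ZMod ℓ, v ≠ 0 ∧ v ^ k = (u : ZMod ℓ); let hull : ℕ → ℕ → ℕ → Prop := fun ℓ k n => ∀ p ∈ n.primeFactors, res ℓ k p; let T : ℕ → ℝ → ℕ → ℝ := fun k x e => (1 - Real.log (e : ℝ) / Real.log x) ^ (-(1 - 1 / (k : ℝ))); let G : ℕ → ℕ → ℕ → ℝ → ℕ → ℝ := fun ℓ k h x d => if Squarefree d ∧ (∀ p ∈ d.primeFactors, res ℓ k p) then (1 / (d : ℝ)) * ∑ e ∈ (d / Nat.gcd d h).divisors, T k x (Nat.gcd d h * e) * T k x (Nat.gcd d h * (d / Nat.gcd d h / e)) else 0; let Ncount : ℕ → ℕ → ℝ → ℝ := fun ℓ k x => (((Finset.Icc 1 ⌊x⌋₊).filter (fun n => hull ℓ k n)).card : ℝ); let piH : ℕ → ℕ → ℝ → ℝ := fun ℓ k x => (((Finset.Icc 1 ⌊x⌋₊).filter (fun p => p.Prime ∧ res ℓ k p)).card : ℝ); let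 Vstar : ℕ → ℕ → ℕ → ℝ → ℝ := fun ℓ k h x => (piH ℓ k x / Ncount ℓ k x) ^ 2 * ∏ p ∈ (primorial (⌈Real.sqrt x⌉₊ - 1)).primeFactors.filter (fun p => res ℓ k p), (1 - (if p ∣ h then (1 : ℝ) else 2) / (p : ℝ)) / (1 - 1 / (p : ℝ)) ^ 2; ∀ ε : ℝ, 0 < ε → ∀ θ : ℝ, 1 / 2 < θ → θ < 1 → ∃ k₀ : ℕ, ∀ k : ℕ, k₀ ≤ k → ∀ h : ℕ, 1 ≤ h → Even h → ∀ᶠ x : ℝ in Filter.atTop, ∀ ℓ : ℕ, ℓ.Prime → (ℓ : ℝ) ≤ Real.log x ^ 8 → k ∣ ℓ - 1 → h < ℓ → ∃ wL wU : ℕ → ℝ, (∀ d : ℕ, |wL d| ≤ 1 ∧ |wU d| ≤ 1) ∧ (∀ d : ℕ, (¬ d ∣ primorial (⌈Real.sqrt x⌉₊ - 1) ∨ x ^ θ < (d : ℝ)) → wL d = 0 ∧ wU d = 0) ∧ (∀ m : ℕ, 1 ≤ m → ∑ d ∈ m.divisors, wL d ≤ (if Nat.Coprime m (primorial (⌈Real.sqrt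 x⌉₊ - 1)) then (1 : ℝ) else 0) ∧ (if Nat.Coprime m (primorial (⌈Real.sqrt x⌉₊ - 1)) then (1 : ℝ) else 0) ≤ ∑ d ∈ m.divisors, wU d) ∧ (1 - ε) * Vstar ℓ k h x ≤ ∑ d ∈ (primorial (⌈Real.sqrt x⌉₊ - 1)).divisors, wL d * G ℓ k h x d ∧ ∑ d ∈ (primorial (⌈Real.sqrt x⌉₊ - 1)).divisors, wU d * G ℓ k h x d ≤ (1 + ε) * Vstar ℓ k h x

/-- item stmt-Parity-13092 · crux · rank 4 · open · by planner
why it might fail: Open binary problem of B-twin type (Indlekofer 1974: only the order, for sums of two squares, via r(n)); the local-density heuristic for a density-zero multiplicative set may miss a global factor (Mertens-type paradox) or fail uniformly in ℓ ≤ (log x)^8; k = 8, x ≤ 10⁹ numerics decide.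
sources: arXiv:1701.01157, doi:10.4064/aa-26-2-207-212, arXiv:1904.12845, arXiv:1106.4690, Tenenbaum2015, HardyLittlewood1923
[crux] (card C1, made explicit) HARDY–LITTLEWOOD FOR HULL PAIRS, ratio form with finite products
only: for every k ≥ 8, even h ≥ 2 and ε > 0, for all large x and every prime ℓ ≤ (log x)^8 with k ∣
ℓ−1, ℓ > h: |x·X(x) − 𝔖^N_x(h)·#N(x)²| ≤ ε·#N(x)², where 𝔖^N_x(h) = [#{u mod ℓ : u, u+h ∈
H}·ℓ/|H|²]·Π_(p<√x, p≠ℓ, p non-split) (1 − ν_h(p)/p)(1 − 1/p)^(−2), |H| = (ℓ−1)/k, ν_h(p) = 1 if p ∣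
h else 2 (split primes impose no local condition on hull membership and contribute no factor; the
factor at ℓ is the compatibility of the two H-classes). This is the k = 2-pair case of the
Freiberg–Kurlberg–Rosenzweig-type k-tuple conjecture for the frobenian set N (their Conj. 1.1 is the
sums-of-two-squares analogue, 𝔖 = Π_(p non-split) δ_h(p)/δ_0(p)^k); finite-complexity correlations
of frobenian functions are theorems (Loughran–Matthiesen), the pair (n, n+h) is infinite complexity.
[difficulty: open-problem] -/
@[route_item "route-Parity-HullDial"]
def HullPairsMass : Prop :=
  let res : ℕ → ℕ → ℕ → Prop := fun ℓ k u => ∃ v : ZMod ℓ, v ≠ 0 ∧ v ^ k = (u : ZMod ℓ); let hull : ℕ → ℕ → ℕ → Prop := fun ℓ k n => ∀ p ∈ n.primeFactors, res ℓ k p; let X : ℕ → ℕ → ℕ → ℝ → ℝ := fun ℓ k h x => (((Finset.Icc 1 ⌊x⌋₊).filter (fun n => hull ℓ k n ∧ hull ℓ k (n + h))).card : ℝ); let Ncount : ℕ → ℕ → ℝ → ℝ := fun ℓ k x => (((Finset.Icc 1 ⌊x⌋₊).filter (fun n => hull ℓ k n)).card : ℝ); let SN : ℕ → ℕ → ℕ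 → ℝ → ℝ := fun ℓ k h x => (((Finset.range ℓ).filter (fun u => res ℓ k u ∧ res ℓ k (u + h))).card : ℝ) * (ℓ : ℝ) / (((ℓ : ℝ) - 1) / (k : ℝ)) ^ 2 * ∏ p ∈ (primorial (⌈Real.sqrt x⌉₊ - 1)).primeFactors.filter (fun p => p ≠ ℓ ∧ ¬ res ℓ k p), (1 - (if p ∣ h then (1 : ℝ) else 2) / (p : ℝ)) / (1 - 1 / (p : ℝ)) ^ 2; ∀ k : ℕ, 8 ≤ k → ∀ h : ℕ, 1 ≤ h → Even h → ∀ ε : ℝ, 0 < ε → ∀ᶠ x : ℝ in Filter.atTop, ∀ ℓ : ℕ, ℓ.Prime → (ℓ : ℝ) ≤ Real.log x ^ 8 → k ∣ ℓ - 1 → h < ℓ → |x * X ℓ k h x - SN ℓ k h x * Ncount ℓ k x ^ 2| ≤ ε * Ncount ℓ k x ^ 2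

/-- item stmt-Parity-13093 · support · rank 9 · open · by planner
sources: IwaniecKowalski2004, MontgomeryVaughan2007, Literature.Barriers.Parity.LargeSieveLevelHalf
[support] PROVABLE NOW (L in Lean): for every k ≥ 1 and h ≥ 1, π₂,h(x) − (1/|L_x|)·Σ_(ℓ ∈ L_x)
S_ℓ(x)/ρ_ℓ = o(x/log²x), where L_x = {primes ℓ ∈ ((log x)^8/2, (log x)^8] : k ∣ ℓ−1, ℓ > h}, S_ℓ(x)
= #{p ≤ x : p, p+h prime, p and p+h non-zero k-th powers mod ℓ}, ρ_ℓ = #{u mod ℓ : u, u+h ∈ H}/#{u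
mod ℓ : u ≢ 0, −h}, π₂,h(x) = #{p ≤ x : p, p+h prime}. Proof: 1_H = (1/k)Σ_(χ^k=1) χ; the trivial
pair gives π₂,h(x)/k² + O((log x)^8); ρ_ℓ = k^(−2)(1 + O(k²ℓ^(−1/2))) by Jacobi sums; the
non-trivial character pairs are bounded by Cauchy–Schwarz over p ≤ x (weights a_p ∈ [0,1], Σa_p ≤
π(x), Chebyshev) against Σ_(n≤x)|Σ_ℓ c_ℓ Σ' χ₁(n)χ₂(n+h)|², whose off-diagonal complete sums mod ℓℓ'
factor into Jacobi-type sums of modulus √(ℓℓ') (plus O(ℓℓ') ≤ (log x)^16 boundary), giving ≪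
k⁴|L_x|x; hence error/main ≍ k²φ(k)^(1/2)(log x)^(3/2)|L_x|^(−1/2) ≍ (log x)^(−5/2+o(1)) → 0 since
|L_x| ≍ (log x)^8/(8φ(k) log log x) (PNT in APs mod k, fixed modulus). [difficulty: provable-now] -/
@[route_item "route-Parity-HullDial"]
def ClassAveraging : Prop :=
  let res : ℕ → ℕ → ℕ → Prop := fun ℓ k u => ∃ v : ZMod ℓ, v ≠ 0 ∧ v ^ k = (u : ZMod ℓ); let S : ℕ → ℕ → ℕ → ℝ → ℝ := fun ℓ k h x => (((Finset.Icc 1 ⌊x⌋₊).filter (fun p => p.Prime ∧ (p + h).Prime ∧ res ℓ k p ∧ res ℓ k (p + h))).card : ℝ); let rho : ℕ → ℕ → ℕ → ℝ := fun ℓ k h => (((Finset.range ℓ).filter (fun u => res ℓ k u ∧ res ℓ k (u + h))).card : ℝ) / (((Finset.range ℓ).filter (fun u : ℕ => (u : ZMod ℓ) ≠ 0 ∧ ((u + h : ℕ) : ZMod ℓ) ≠ 0)).card : ℝ); let L : ℕ → ℕ → ℝ → Finset ℕ := fun k h x => (Finset.Ioc (⌊Real.log x ^ 8⌋₊ / 2)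 ⌊Real.log x ^ 8⌋₊).filter (fun ℓ => ℓ.Prime ∧ k ∣ ℓ - 1 ∧ h < ℓ); let π₂ : ℕ → ℝ → ℝ := fun h x => (((Finset.Icc 1 ⌊x⌋₊).filter (fun p => p.Prime ∧ (p + h).Prime)).card : ℝ); ∀ k : ℕ, 1 ≤ k → ∀ h : ℕ, 1 ≤ h → (fun x : ℝ => π₂ h x - (∑ ℓ ∈ L k h x, S ℓ k h x / rho ℓ k h) / ((L k h x).card : ℝ)) =o[Filter.atTop] fun x : ℝ => x / Real.log x ^ 2

/-- item stmt-Parity-13094 · support · rank 9 · open · by planner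
sources: IwaniecActaArith1980, HardyLittlewood1923, Literature.NumberTheory.Sieve.tendsto_singularSeriesPartial_holds, Literature.NumberTheory.LFunctions.siegel_walfisz_holds
[support] PROVABLE BOOKKEEPING (M/L): HullPairsLevel → HullPairsMass → DialSieveWeights →
ClassAveraging → PairsHL (PairsHL spelled out verbatim so the decl does not depend on rendering
order). Fix h; odd h: 𝔖({0,h}) = 0 (tree singularSeriesFactor_eq_zero at p = 2) and
Σ_(n≤N)Λ(n)Λ(n+h) ≪ log³N (one of n, n+h is a power of 2). Even h, ε > 0: take θ from L, k ≥ max(8,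
k₀(ε, θ)) from W; for large x and each ℓ ∈ L_x the weights give X[(1−ε)V* − (log x)^(−2/k−δ)] ≤ S ≤
X[(1+ε)V* + (log x)^(−2/k−δ)] for the survivors S = #{n ≤ x : n, n+h ∈ N, (n(n+h), P(√x)) = 1} =
S_ℓ(x) + O(√x) (a hull number ≤ x+h free of primes < √x is 1, a prime in H, or q² with q ≥ √x), and
(log x)^(−2/k−δ) = o(V*) uniformly in ℓ ≤ (log x)^8 (V* ≍ (log x)^(−2/k)·(log ℓ)^(O(1/k))/k²). With
M: S_ℓ = 𝔖^N_x·Π_(split p<√x)HL_h(p)·π_H(x)²/x·(1 ± 3ε) = [#{u,u+h∈H}ℓ/|H|²]·[Π_(p<√x,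
p≠ℓ)HL_h(p)]·[|H|/(ℓ−1)·x/log x]²/x·(1 ± 4ε) (Siegel–Walfisz for π_H, tree siegel_walfisz_holds;
singularSeriesPartial → 𝔖(h), tree tendsto_singularSeriesPartial_holds) =
#{u,u+h∈H}·ℓ/((ℓ−1)²−1)·𝔖(h)x/log²x(1 ± 5ε) = ρ_ℓ·𝔖(h)·x/log²x·(1 ± 5ε) since (ℓ−1)²−1 = ℓ(ℓ−2) and
#{u : u ≢ 0,−h} = ℓ−2. ClassAveraging then gives π₂,h(x) = 𝔖(h)x/log²x(1 ± -/
@[route_item "route-Parity-HullDial"]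
def DialAssembly : Prop :=
  HullPairsLevel → HullPairsMass → DialSieveWeights → ClassAveraging → ∀ h : ℕ, 1 ≤ h → (fun N : ℕ => ∑ n ∈ Finset.Icc 1 N, ArithmeticFunction.vonMangoldt n * ArithmeticFunction.vonMangoldt (n + h) - Literature.NumberTheory.Sieve.singularSeries ({0, (h : ℤ)} : Finset ℤ) * N) =o[Filter.atTop] fun N : ℕ => (N : ℝ)

/-- item stmt-Parity-13095 · support · rank 9 · open · by planner
sources: IwaniecActaArith1980, doi:10.4064/aa-29-1-69-95, Greaves2001, FriedlanderIwaniecOpera2010, Literature.NumberTheory.Sieve.SieveSequence.half_dimensional_sieve_lower_holds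
[support] (card headline as repaired by refuter-triage-10 / gen-1; NOT a hypothesis of `closes`;
first milestone and cheapest kit falsifier) at degree k = 8 the β = 1 ROSSER LOWER SIEVE HAS A
POSITIVE MAIN TERM for the tilted two-colour model: for every θ ∈ (1/2, 3/5] and even h there is c >
0 with, for all large x and every prime ℓ ≤ (log x)^8, 8 ∣ ℓ−1, ℓ > h: Σ_(d∣P(√x))
μ(d)χ⁻_(x^θ)(d)G_x(d) ≥ c·V*(x), χ⁻ = Rosser's lower truncation with β = 1 written non-recursively
(for each prime q ∣ d of even rank m from the top, (Π_(p∣d, p≥q) p)·q < x^θ; = tree BetaSieve.ind 0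
1 (x^θ)). By gen-1's a/d law the tilted local dimension over Buchstab states reachable with d < x^θ,
θ ≤ 0.7, is ≤ 2·(1/8)·2^(7/8) = 0.458 < 1/2, so Iwaniec's one-sided Ω(1/2) comparison applies state
by state and the sum is ≥ (f_(1/2)(2θ) − o(1))·(single functional)²·(split factors), f_(1/2)(1.1) =
0.447, f_(1/2)(1.2) = 0.596. With HullPairsLevel at k = 8 and any lower bound X ≫ x(log x)^(−2) this
yields infinitely many prime pairs (p, p+h) in H×H (Polignac for every even h in power-residue
classes) via tree lowerSum_le_sifted — the route's lower-bound milestone, not needed by `closes`.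
[difficulty: L] -/
@[route_item "route-Parity-HullDial"]
def DegreeEightPositivity : Prop :=
  let res : ℕ → ℕ → ℕ → Prop := fun ℓ k u => ∃ v : ZMod ℓ, v ≠ 0 ∧ v ^ k = (u : ZMod ℓ); let hull : ℕ → ℕ → ℕ → Prop := fun ℓ k n => ∀ p ∈ n.primeFactors, res ℓ k p; let T : ℕ → ℝ → ℕ → ℝ := fun k x e => (1 - Real.log (e : ℝ) / Real.log x) ^ (-(1 - 1 / (k : ℝ))); let G : ℕ → ℕ → ℕ → ℝ → ℕ → ℝ := fun ℓ k h x d => if Squarefree d ∧ (∀ p ∈ d.primeFactors, res ℓ k p) then (1 / (d : ℝ)) * ∑ e ∈ (d / Nat.gcd d h).divisors, T k x (Nat.gcd d h * e) * T k x (Nat.gcd d h * (d / Nat.gcd d h / e)) else 0; let Ncount : ℕ → ℕ → ℝ → ℝ := fun ℓ k x => (((Finset.Icc 1 ⌊x⌋₊).filter (fun n => hull ℓ k n)).card : ℝ); let piH : ℕ → ℕ → ℝ → ℝ := fun ℓ k x => (((Finset.Icc 1 ⌊x⌋₊).filter (fun p => p.Prime ∧ res ℓ k p)).card : ℝ); let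 Vstar : ℕ → ℕ → ℕ → ℝ → ℝ := fun ℓ k h x => (piH ℓ k x / Ncount ℓ k x) ^ 2 * ∏ p ∈ (primorial (⌈Real.sqrt x⌉₊ - 1)).primeFactors.filter (fun p => res ℓ k p), (1 - (if p ∣ h then (1 : ℝ) else 2) / (p : ℝ)) / (1 - 1 / (p : ℝ)) ^ 2; let chiL : ℝ → ℕ → ℝ := fun D d => if (∀ q ∈ d.primeFactors, ((d.primeFactors.filter (fun p => q ≤ p)).card % 2 = 0 → (∏ p ∈ d.primeFactors.filter (fun p => q ≤ p), (p : ℝ)) * (q : ℝ) < D)) then 1 else 0; ∀ θ : ℝ, 1 / 2 < θ → θ ≤ 3 / 5 → ∀ h : ℕ, 1 ≤ h → Even h → ∃ c : ℝ, 0 < c ∧ ∀ᶠ x : ℝ in Filter.atTop, ∀ ℓ : ℕ, ℓ.Prime → (ℓ : ℝ) ≤ Real.log x ^ 8 → 8 ∣ ℓ - 1 → h < ℓ → c * Vstar ℓ 8 h x ≤ ∑ d ∈ (primorial (⌈Real.sqrt x⌉₊ - 1)).divisors, (ArithmeticFunction.moebius d : ℝ) * chiL (x ^ θ) d * G ℓ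 8 h x d

/-- item stmt-Parity-9387 · support · rank 9 · open · by planner
sources: HardyLittlewood1923, GreenTao2010
[support] Hardy–Littlewood pairs, Λ-form, fixed shift: for every h ≥ 1, Σ_{n≤N} Λ(n)Λ(n+h) =
𝔖({0,h})·N + o(N). Verbatim the signature of TauberianTwins.PairsHL (stmt-Parity-0867): the terminal
statement of this bridge (k-tuples and shift-uniform GHL are NOT claimed; see route DicksonFibration
for PairsHL → DimOne → GHL). [difficulty: open-problem] -/
@[route_item "route-Parity-HullDial"]
def PairsHL : Prop :=
  ∀ h : ℕ, 1 ≤ h → (fun N : ℕ => ∑ n ∈ Finset.Icc 1 N, ArithmeticFunction.vonMangoldt n * ArithmeticFunction.vonMangoldt (n + h) - Literature.NumberTheory.Sieve.singularSeries ({0, (h : ℤ)} : Finset ℤ) * N) =o[Filter.atTop] fun N : ℕ => (N : ℝ)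

/-- item stmt-Parity-9389 · support · rank 9 · open · by planner
sources: GreenTao2010, MatomakiMerikoski2023, HardyLittlewood1923
[support] (RESIDUAL — GHL-hard, NOT addressed by this mechanism; filed so that `closes` decides the
sub-problem, D-0027 §2.1) fixed-shift Hardy–Littlewood pairs (the PairsHL statement, inlined) →
GeneralizedHardyLittlewood (Green–Tao Conj. 1.2, all d, t, L, convex K). Contains: prime k-tuples
for every k ≥ 3 at fixed shifts (a k-fold version of the rigidity would first need 'tuple-GEH':
level 1 for (k−1)-fold products of shifted prime/rough weights); general slopes a_i n + b_i;
shift-uniformity |b_i| ≤ LN (Landau–Siegel-hard: a Siegel zero mod q forces ΣΛ(n)Λ(n+q) ≈ 2𝔖_q x,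
MatomakiMerikoski2023 Thm 1.3); and the fibration d ≥ 2 ⇐ d = 1 (route DicksonFibration, provable).
True if GHL is; unprovable by anything here. [difficulty: open-problem] -/
@[route_item "route-Parity-HullDial"]
def PairsToGHL : Prop :=
  (∀ h : ℕ, 1 ≤ h → (fun N : ℕ => ∑ n ∈ Finset.Icc 1 N, ArithmeticFunction.vonMangoldt n * ArithmeticFunction.vonMangoldt (n + h) - Literature.NumberTheory.Sieve.singularSeries ({0, (h : ℤ)} : Finset ℤ) * N) =o[Filter.atTop] fun N : ℕ => (N : ℝ)) → GeneralizedHardyLittlewood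

/-- item stmt-Parity-13096 · assembly · rank 1 · open · by planner
sources: IwaniecActaArith1980, HardyLittlewood1923, GreenTao2010
[assembly] HullPairsLevel → HullPairsMass → DialSieveWeights → ClassAveraging → DialAssembly →
PairsToGHL → GeneralizedHardyLittlewood (the type of `closes`). -/
@[route_item "route-Parity-HullDial"]
def Assembly : Prop :=
  HullPairsLevel → HullPairsMass → DialSieveWeights → ClassAveraging → DialAssembly → PairsToGHL → GeneralizedHardyLittlewood

/-! D-0027 §2.1 — DECIDING THEOREM (planner-authored via `route open/edit --closes-file`; by planner-plancard-Parity-GeneralizedHardyLittl-d0f3a14a-g2-0 2026-08-15T19:00:13Z):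
its hypotheses are this route's items and its conclusion the sub-problem Statement (glue_lint), and it elaborates with this file. -/

/-- D-0027 §2.1 deciding theorem of route HullDial (card quartic-hull-descent, gen 2). The three cruxes
`HullPairsLevel` (level θ > 1/2 for pairs of power-residue hull numbers, tilted model), `HullPairsMass`
(Hardy–Littlewood mass for hull pairs) and `DialSieveWeights` (dimension → 0 sieves are exact for the tilted
model), together with the provable `ClassAveraging` (Jacobi sums + large sieve over auxiliary primes ℓ), give
Hardy–Littlewood for prime pairs at every fixed shift through the bookkeeping item `DialAssembly`; the declared
GHL-hard residual `PairsToGHL` (shared with RoughSemiprimeRigidity) carries fixed-shift pairs to the sub-problem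
Statement. Pure logic. `DegreeEightPositivity` and `PairsHL` are items but not hypotheses. -/
@[closes "route-Parity-HullDial"] theorem closes (hL : HullPairsLevel) (hM : HullPairsMass) (hW : DialSieveWeights) (hC : ClassAveraging)
    (hD : DialAssembly) (hG : PairsToGHL) : _root_.GeneralizedHardyLittlewood :=
  hG (hD hL hM hW hC)

end Summit.Parity.GeneralizedHardyLittlewood.Theses.HullDial
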